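import Mathlib.Analysis.Calculus.ContDiff.Operations
import Mathlib.Analysis.Calculus.LineDeriv.Basic
import Literature.NumberTheory.Transcendental.PhilipponZeroEstimateOperators
import Literature.NumberTheory.Transcendental.DirectionalJets
import HarnessLib

/-!
# Philippon's zero estimate on `𝔾ₐ × 𝔾ₘ^m`: the order of vanishing along an analytic subgroup

Topic `Literature/NumberTheory/Transcendental`. Second module of the inline discharge of
`Literature.NumberTheory.Transcendental.Philippon1986_GaGm` (`PhilipponZeroEstimate.lean`). The
named fact encodes "`P` vanishes to order `≥ N` at `g` along `A = exp_G(W)`"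
(`GaGm.VanishesToOrder P W g N`) analytically: all Fréchet derivatives of order `< N` of
`w ↦ P(g · exp_G w)` on `W` vanish at `0`. The algebraic proof (Roy, LNM 1752 Ch. 11, §3,
Definition 3.2 and Proposition 3.6 (iii)) works instead with the invariant derivations `D_u`,
`u ∈ W` (`GaGm.invDeriv`, `PhilipponZeroEstimateOperators.lean`). PROVED here, the dictionary
between the two:

* `GaGm.contDiff_evalAt_mul_exp` — `w ↦ P(g · exp_G w)` is `C^ω` on `Lie G = ℂ × ℂ^m`;
* `GaGm.iteratedDeriv_evalAt_mul_exp_line` — its line jets are values of iterated invariant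
  derivations: `d^k/dt^k P(g · exp_G(v + t u))|_{t=0} = (D_u^k P)(g · exp_G v)`;
* `GaGm.wordDeriv u P = D_{u₀} ⋯ D_{u_{k-1}} P` (words of invariant derivations) and
  **`GaGm.iteratedFDeriv_evalAt_mul_exp_apply`** — mixed jets are values of words:
  `D^k f(v)(u₀, …, u_{k-1}) = (D_{u₀} ⋯ D_{u_{k-1}} P)(g · exp_G v)` (induction on `k`:
  `fderiv` in a fixed direction is `w ↦ (D_e P)(g exp_G w)`, and evaluation commutes with `D^k`);
  the same for the restriction to `W` (`…_restrict_apply`);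
* **`GaGm.vanishesToOrder_iff_wordDeriv`** / **`GaGm.vanishesToOrder_iff_invDeriv`** —
  `VanishesToOrder P W g N ↔` all words of length `< N` in letters from `W` kill `P` at `g`
  `↔ ∀ k < N, ∀ u ∈ W, (D_u^k P)(g) = 0` (the diagonal form by polarization, `DirectionalJets.lean`);
* consequences used downstream: translation to the origin
  (`GaGm.vanishesToOrder_iff_invDeriv_transl`, `GaGm.vanishesToOrder_mul_iff`), closure under the
  operators (`GaGm.VanishesToOrder.invDeriv`, `….invDeriv_iterate`) and under the ideal operations
  (`GaGm.VanishesToOrder.mul_left`, `.add`, `.sum_mul`).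

## References

* Yu. V. Nesterenko, P. Philippon (eds.), *Introduction to Algebraic Independence Theory*,
  LNM 1752, Springer 2001, Ch. 11 (D. Roy), §3, Def. 3.2, Lemma 3.3, Prop. 3.6 (iii).
* P. Philippon, *Lemmes de zéros dans les groupes algébriques commutatifs*, BSMF 114 (1986),
  355–383, §2 (p. 358: `ord_g P`), Prop. 4.4.
-/

noncomputable section

open MvPolynomial Complex
open scoped ContDiff

namespace Literature.NumberTheory.Transcendental

namespace GaGm

variable {m : ℕ}

/-! ### Smoothness of `w ↦ P(g · exp_G w)` -/

/-- Coordinates of `g · exp_G(v)`: `(g₀ + v₀, g_j e^{v_j})`. [folklore] -/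
theorem coord_mul_exp (g : GaGm m) (v : ℂ × (Fin m → ℂ)) :
    coord (g * exp v) = Fin.cons (Multiplicative.toAdd g.1 + v.1)
      fun j => ((g.2 j : ℂˣ) : ℂ) * Complex.exp (v.2 j) := by
  have h := coord_mul_exp_add_smul g v 0 0
  simp only [smul_zero, add_zero] at h
  rw [h]
  funext i
  refine Fin.cases ?_ (fun j => ?_) i <;> simp [flow, exp, add_comm]

/-- **`w ↦ P(g · exp_G w)` is analytic (`C^ω`) on `Lie G`**: it is a polynomial in
`w₀` and the `e^{v_j}`. [folklore] -/
theorem contDiff_evalAt_mul_exp (P : MvPolynomial (Fin (m + 1)) ℂ) (g : GaGm m) {n : WithTop ℕ∞} :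
    ContDiff ℂ n fun v : ℂ × (Fin m → ℂ) => evalAt P (g * exp v) := by
  simp only [evalAt, coord_mul_exp]
  induction P using MvPolynomial.induction_on with
  | C a => simpa using contDiff_const
  | add p q hp hq => simpa using hp.add hq
  | mul_X p i hp =>
    simp only [map_mul, eval_X]
    refine hp.mul ?_
    refine Fin.cases ?_ (fun j => ?_) i
    · simp only [Fin.cons_zero]
      exact contDiff_const.add contDiff_fst
    · simp only [Fin.cons_succ]
      exact contDiff_const.mul ((contDiff_apply ℂ ℂ j).comp contDiff_snd).cexp

/-- **Line jets along the analytic subgroup are values of iterated invariant derivations**: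
`d^k/dt^k P(g · exp_G(v + t u))|_{t=0} = (D_u^k P)(g · exp_G v)` (Roy, Lemma 3.3 and the
definition of `∂^κ`, for `𝔾ₐ × 𝔾ₘ^m`). [cite: NesterenkoPhilippon2001, Ch. 11 Lemma 3.3] -/
theorem iteratedDeriv_evalAt_mul_exp_line (P : MvPolynomial (Fin (m + 1)) ℂ) (g : GaGm m)
    (v u : ℂ × (Fin m → ℂ)) (k : ℕ) :
    iteratedDeriv k (fun t : ℂ => evalAt P (g * exp (v + t • u))) 0 =
      evalAt ((invDeriv u)^[k] P) (g * exp v) := by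
  have h : (fun t : ℂ => evalAt P (g * exp (v + t • u))) =
      fun t => eval (flow (coord (g * exp v)) u t) P := by
    funext t
    simp only [evalAt, coord_mul_exp_add_smul]
  rw [h, iteratedDeriv_eval_flow, flow_zero, evalAt]

/-! ### Words of invariant derivations and mixed jets -/

/-- The word `D_{u₀} ∘ D_{u₁} ∘ ⋯ ∘ D_{u_{k-1}}` of invariant derivations applied to `P`
(the last vector acts first): `wordDeriv u P = wordDeriv (init u) (D_{u (last)} P)`. [folklore] -/
def wordDeriv : {k : ℕ} → (Fin k → ℂ × (Fin m → ℂ)) → MvPolynomial (Fin (m + 1)) ℂ →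
    MvPolynomial (Fin (m + 1)) ℂ
  | 0, _, P => P
  | _ + 1, u, P => wordDeriv (Fin.init u) (invDeriv (u (Fin.last _)) P)

/-- The empty word is the identity. [folklore] -/
@[simp] theorem wordDeriv_zero (u : Fin 0 → ℂ × (Fin m → ℂ)) (P : MvPolynomial (Fin (m + 1)) ℂ) :
    wordDeriv u P = P := rfl

/-- Recursion of words. [folklore] -/
theorem wordDeriv_succ {k : ℕ} (u : Fin (k + 1) → ℂ × (Fin m → ℂ))
    (P : MvPolynomial (Fin (m + 1)) ℂ) :
    wordDeriv u P = wordDeriv (Fin.init u) (invDeriv (u (Fin.last k)) P) := rfl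

/-- A constant word is an iterate: `wordDeriv (u, …, u) P = D_u^k P`. [folklore] -/
theorem wordDeriv_const (k : ℕ) (u : ℂ × (Fin m → ℂ)) (P : MvPolynomial (Fin (m + 1)) ℂ) :
    wordDeriv (fun _ : Fin k => u) P = (invDeriv u)^[k] P := by
  induction k generalizing P with
  | zero => rfl
  | succ k ih =>
    rw [wordDeriv_succ, Function.iterate_succ_apply]
    exact ih (invDeriv u P)

/-- Translations commute with words: `τ_g (wordDeriv u P) = wordDeriv u (τ_g P)`. [folklore] -/
theorem transl_wordDeriv (g : GaGm m) {k : ℕ} (u : Fin k → ℂ × (Fin m → ℂ))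
    (P : MvPolynomial (Fin (m + 1)) ℂ) : transl g (wordDeriv u P) = wordDeriv u (transl g P) := by
  induction k generalizing P with
  | zero => rfl
  | succ k ih => rw [wordDeriv_succ, wordDeriv_succ, ih, transl_invDeriv]

/-- Prepending a letter: `wordDeriv (e, t) P = D_e (wordDeriv t P)`. [folklore] -/
theorem wordDeriv_cons {j : ℕ} (e : ℂ × (Fin m → ℂ)) (t : Fin j → ℂ × (Fin m → ℂ))
    (P : MvPolynomial (Fin (m + 1)) ℂ) :
    wordDeriv (Fin.cons e t : Fin (j + 1) → ℂ × (Fin m → ℂ)) P = invDeriv e (wordDeriv t P) := by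
  induction j generalizing P with
  | zero =>
    rw [wordDeriv_succ]
    have h1 : (Fin.cons e t : Fin (0 + 1) → ℂ × (Fin m → ℂ)) (Fin.last 0) = e := rfl
    rw [h1]
    rfl
  | succ j ih =>
    rw [wordDeriv_succ]
    have h1 : (Fin.cons e t : Fin (j + 1 + 1) → ℂ × (Fin m → ℂ)) (Fin.last (j + 1)) = t (Fin.last j) := by
      rw [← Fin.succ_last, Fin.cons_succ]
    have h2 : Fin.init (Fin.cons e t : Fin (j + 1 + 1) → ℂ × (Fin m → ℂ)) =
        Fin.cons e (Fin.init t) := by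
      funext i
      refine Fin.cases ?_ (fun i' => ?_) i
      · rfl
      · simp only [Fin.init, Fin.cons_succ, Fin.castSucc_succ]
    rw [h1, h2, ih]
    rfl

/-- Words are additive in the polynomial. [folklore] -/
theorem wordDeriv_add {k : ℕ} (u : Fin k → ℂ × (Fin m → ℂ)) (Q R : MvPolynomial (Fin (m + 1)) ℂ) :
    wordDeriv u (Q + R) = wordDeriv u Q + wordDeriv u R := by
  induction k generalizing Q R with
  | zero => rfl
  | succ k ih => rw [wordDeriv_succ, wordDeriv_succ, wordDeriv_succ, map_add, ih]

/-- Words kill `0`. [folklore] -/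
@[simp] theorem wordDeriv_zero_right {k : ℕ} (u : Fin k → ℂ × (Fin m → ℂ)) :
    wordDeriv u (0 : MvPolynomial (Fin (m + 1)) ℂ) = 0 := by
  induction k with
  | zero => rfl
  | succ k ih => rw [wordDeriv_succ, map_zero, ih]

/-- The Fréchet derivative of `w ↦ P(g · exp_G w)` in the direction `e` is `w ↦ (D_e P)(g · exp_G w)`.
[folklore] -/
theorem fderiv_evalAt_mul_exp_apply (P : MvPolynomial (Fin (m + 1)) ℂ) (g : GaGm m)
    (y e : ℂ × (Fin m → ℂ)) :
    fderiv ℂ (fun v : ℂ × (Fin m → ℂ) => evalAt P (g * exp v)) y e =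
      evalAt (invDeriv e P) (g * exp y) := by
  have hd : DifferentiableAt ℂ (fun v : ℂ × (Fin m → ℂ) => evalAt P (g * exp v)) y :=
    ((contDiff_evalAt_mul_exp P g (n := 1)).differentiable one_ne_zero).differentiableAt
  rw [← hd.lineDeriv_eq_fderiv]
  have h := iteratedDeriv_evalAt_mul_exp_line P g y e 1
  rw [iteratedDeriv_one, Function.iterate_one] at h
  exact h

/-- **Mixed jets are values of words of invariant derivations**: for the `C^ω` map
`f(w) = P(g · exp_G w)` on `Lie G`, `D^k f(v)(u₀, …, u_{k-1}) = (D_{u₀} ⋯ D_{u_{k-1}} P)(g · exp_G v)`.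
[folklore] -/
theorem iteratedFDeriv_evalAt_mul_exp_apply (k : ℕ) (P : MvPolynomial (Fin (m + 1)) ℂ) (g : GaGm m)
    (v : ℂ × (Fin m → ℂ)) (u : Fin k → ℂ × (Fin m → ℂ)) :
    iteratedFDeriv ℂ k (fun w : ℂ × (Fin m → ℂ) => evalAt P (g * exp w)) v u =
      evalAt (wordDeriv u P) (g * exp v) := by
  induction k generalizing P v with
  | zero => simp
  | succ k ih =>
    rw [iteratedFDeriv_succ_apply_right, wordDeriv_succ]
    -- evaluation at `u (last k)` is a continuous linear map, hence commutes with `D^k`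
    set e := u (Fin.last k) with he
    have hF : ContDiff ℂ ω (fderiv ℂ fun w : ℂ × (Fin m → ℂ) => evalAt P (g * exp w)) :=
      (contDiff_evalAt_mul_exp P g).fderiv_right le_rfl
    have hcomp : (fun y : ℂ × (Fin m → ℂ) => fderiv ℂ (fun w => evalAt P (g * exp w)) y e) =
        (ContinuousLinearMap.apply ℂ ℂ e) ∘ fderiv ℂ (fun w => evalAt P (g * exp w)) := by
      funext y
      simp
    have h1 : iteratedFDeriv ℂ k (fun y => fderiv ℂ (fun w : ℂ × (Fin m → ℂ) => evalAt P (g * exp w)) y)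
        v (Fin.init u) e =
        iteratedFDeriv ℂ k (fun y => fderiv ℂ (fun w : ℂ × (Fin m → ℂ) => evalAt P (g * exp w)) y e)
          v (Fin.init u) := by
      rw [hcomp, ContinuousLinearMap.iteratedFDeriv_comp_left _ hF.contDiffAt
        (le_top : (k : WithTop ℕ∞) ≤ ω)]
      simp
    rw [h1]
    have h2 : (fun y => fderiv ℂ (fun w : ℂ × (Fin m → ℂ) => evalAt P (g * exp w)) y e) =
        fun y => evalAt (invDeriv e P) (g * exp y) := funext fun y => fderiv_evalAt_mul_exp_apply P g y e
    rw [h2, ih]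

/-- The same for the restriction to a subspace `W ⊆ Lie G` (the function of
`GaGm.VanishesToOrder`): `D^k(f|_W)(v)(u) = (D_{u₀} ⋯ D_{u_{k-1}} P)(g · exp_G v)`. [folklore] -/
theorem iteratedFDeriv_evalAt_mul_exp_restrict_apply (k : ℕ) (P : MvPolynomial (Fin (m + 1)) ℂ)
    (g : GaGm m) (W : Submodule ℂ (ℂ × (Fin m → ℂ))) (v : W) (u : Fin k → W) :
    iteratedFDeriv ℂ k (fun w : W => evalAt P (g * exp (w : ℂ × (Fin m → ℂ)))) v u =
      evalAt (wordDeriv (fun i => (u i : ℂ × (Fin m → ℂ))) P) (g * exp (v : ℂ × (Fin m → ℂ))) := by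
  have hcomp : (fun w : W => evalAt P (g * exp (w : ℂ × (Fin m → ℂ)))) =
      (fun w : ℂ × (Fin m → ℂ) => evalAt P (g * exp w)) ∘ W.subtypeL := funext fun w => rfl
  rw [hcomp, ContinuousLinearMap.iteratedFDeriv_comp_right _ (contDiff_evalAt_mul_exp P g) _
    (le_top : (k : WithTop ℕ∞) ≤ ω), ContinuousMultilinearMap.compContinuousLinearMap_apply,
    iteratedFDeriv_evalAt_mul_exp_apply]
  rfl

/-! ### The dictionary -/

/-- **Order of vanishing along `exp_G(W)` in terms of words of invariant derivations** (Roy,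
LNM 1752 Ch. 11, Def. 3.2 / Prop. 3.6 (iii), for `G = 𝔾ₐ × 𝔾ₘ^m`): `P` vanishes to order `≥ N` at
`g` along `A = exp_G(W)` iff `(D_{u₀} ⋯ D_{u_{k-1}} P)(g) = 0` for all `k < N` and all
`u₀, …, u_{k-1} ∈ W`. [cite: NesterenkoPhilippon2001, Ch. 11 Prop. 3.6 (iii)] -/
theorem vanishesToOrder_iff_wordDeriv (P : MvPolynomial (Fin (m + 1)) ℂ)
    (W : Submodule ℂ (ℂ × (Fin m → ℂ))) (g : GaGm m) (N : ℕ) :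
    VanishesToOrder P W g N ↔
      ∀ k < N, ∀ u : Fin k → ℂ × (Fin m → ℂ), (∀ i, u i ∈ W) → evalAt (wordDeriv u P) g = 0 := by
  constructor
  · intro h k hk u hu
    have h0 : iteratedFDeriv ℂ k (fun w : W => evalAt P (g * exp (w : ℂ × (Fin m → ℂ)))) 0 = 0 :=
      h k hk
    have h1 : iteratedFDeriv ℂ k (fun w : W => evalAt P (g * exp (w : ℂ × (Fin m → ℂ)))) 0
        (fun i => ⟨u i, hu i⟩) = 0 := by
      rw [h0]
      rfl
    rw [iteratedFDeriv_evalAt_mul_exp_restrict_apply] at h1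
    simpa using h1
  · intro h k hk
    ext u
    rw [iteratedFDeriv_evalAt_mul_exp_restrict_apply]
    simpa using h k hk (fun i => (u i : ℂ × (Fin m → ℂ))) (fun i => (u i).2)

/-- **Diagonal form** (only iterates `D_u^k` are needed): `P` vanishes to order `≥ N` at `g` along
`exp_G(W)` iff `(D_u^k P)(g) = 0` for all `k < N` and all `u ∈ W` — `⇐` by polarization
(`DirectionalJets.lean`: a symmetric multilinear map vanishing on the diagonal of `W` vanishes on
`W^k`). [cite: NesterenkoPhilippon2001, Ch. 11 Def. 3.2] -/
theorem vanishesToOrder_iff_invDeriv (P : MvPolynomial (Fin (m + 1)) ℂ)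
    (W : Submodule ℂ (ℂ × (Fin m → ℂ))) (g : GaGm m) (N : ℕ) :
    VanishesToOrder P W g N ↔ ∀ k < N, ∀ u ∈ W, evalAt ((invDeriv u)^[k] P) g = 0 := by
  constructor
  · intro h k hk u hu
    rw [← wordDeriv_const]
    exact (vanishesToOrder_iff_wordDeriv P W g N).mp h k hk (fun _ => u) fun _ => hu
  · intro h k hk
    set fW : W → ℂ := fun w => evalAt P (g * exp (w : ℂ × (Fin m → ℂ))) with hfW_def
    have hfW : ContDiff ℂ ω fW :=
      (contDiff_evalAt_mul_exp P g).comp W.subtypeL.contDiff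
    have hjets : ∀ x ∈ (⊤ : Submodule ℂ W), ∀ k < N,
        iteratedDeriv k (fun t : ℂ => fW (0 + t • x)) 0 = 0 := by
      intro x _ k hk
      rw [iteratedDeriv_line_eq_iteratedFDeriv hfW 0 x (le_top : (k : WithTop ℕ∞) ≤ ω), hfW_def,
        iteratedFDeriv_evalAt_mul_exp_restrict_apply, wordDeriv_const]
      simpa using h k hk x x.2
    show iteratedFDeriv ℂ k fW 0 = 0
    ext v
    simpa using iteratedFDeriv_eq_zero_of_lineJets hfW ⊤ 0 N hjets hk v
      (fun _ => Submodule.mem_top)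

/-- **Translation to the origin**: `P` vanishes to order `≥ N` at `g` along `exp_G(W)` iff
`(D_u^k (τ_g P))(e) = 0` for all `k < N`, `u ∈ W` (invariance `τ_g ∘ D_u = D_u ∘ τ_g`). [folklore] -/
theorem vanishesToOrder_iff_invDeriv_transl (P : MvPolynomial (Fin (m + 1)) ℂ)
    (W : Submodule ℂ (ℂ × (Fin m → ℂ))) (g : GaGm m) (N : ℕ) :
    VanishesToOrder P W g N ↔
      ∀ k < N, ∀ u ∈ W, evalAt ((invDeriv u)^[k] (transl g P)) 1 = 0 := by
  rw [vanishesToOrder_iff_invDeriv]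
  refine forall₂_congr fun k _ => forall₂_congr fun u _ => ?_
  rw [← evalAt_invDeriv_iterate_mul, mul_one]

/-- `VanishesToOrder` is translation-equivariant: `P` vanishes to order `≥ N` at `g · h` iff `τ_g P`
vanishes to order `≥ N` at `h`. [folklore] -/
theorem vanishesToOrder_mul_iff (P : MvPolynomial (Fin (m + 1)) ℂ)
    (W : Submodule ℂ (ℂ × (Fin m → ℂ))) (g h : GaGm m) (N : ℕ) :
    VanishesToOrder P W (g * h) N ↔ VanishesToOrder (transl g P) W h N := by
  rw [vanishesToOrder_iff_invDeriv, vanishesToOrder_iff_invDeriv]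
  refine forall₂_congr fun k _ => forall₂_congr fun u _ => ?_
  rw [evalAt_invDeriv_iterate_mul]

/-- **Closure under the operators**: if `P` vanishes to order `≥ N + 1` at `g` along `exp_G(W)`
then `D_u P`, `u ∈ W`, vanishes to order `≥ N` there (Roy, Lemma 3.3: a word followed by `D_u` is a
longer word). [cite: NesterenkoPhilippon2001, Ch. 11 Lemma 3.3] -/
theorem VanishesToOrder.invDeriv {P : MvPolynomial (Fin (m + 1)) ℂ}
    {W : Submodule ℂ (ℂ × (Fin m → ℂ))} {g : GaGm m} {N : ℕ}
    (h : VanishesToOrder P W g (N + 1)) {u : ℂ × (Fin m → ℂ)} (hu : u ∈ W) :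
    VanishesToOrder (GaGm.invDeriv u P) W g N := by
  rw [vanishesToOrder_iff_wordDeriv] at h ⊢
  intro k hk u' hu'
  have h1 := h (k + 1) (Nat.succ_lt_succ hk) (Fin.snoc u' u) (by
    intro i
    refine Fin.lastCases ?_ (fun j => ?_) i
    · simpa using hu
    · simpa using hu' j)
  rwa [wordDeriv_succ, Fin.init_snoc, Fin.snoc_last] at h1

/-- Iterated closure: order `≥ N + k` for `P` gives order `≥ N` for `D_u^k P`. [folklore] -/
theorem VanishesToOrder.invDeriv_iterate {P : MvPolynomial (Fin (m + 1)) ℂ}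
    {W : Submodule ℂ (ℂ × (Fin m → ℂ))} {g : GaGm m} {N : ℕ} {u : ℂ × (Fin m → ℂ)} (hu : u ∈ W) :
    ∀ (k : ℕ), VanishesToOrder P W g (N + k) → VanishesToOrder ((GaGm.invDeriv u)^[k] P) W g N
  | 0, h => by simpa using h
  | k + 1, h => by
    rw [Function.iterate_succ_apply']
    have h' : VanishesToOrder ((GaGm.invDeriv u)^[k] P) W g (N + 1) :=
      VanishesToOrder.invDeriv_iterate hu k (N := N + 1) (by
        rw [show N + 1 + k = N + (k + 1) by omega]
        exact h)
    exact h'.invDeriv hu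

/-- Words and left multiplication: `wordDeriv u (a P)` is an `A`-linear combination of words of
length `≤ |u|` in the same letters applied to `P` — recorded in the weak form we need:
if every word of length `< N` in letters from `W` kills `P` at `g`, the same holds for `a · P`
(Leibniz). [folklore] -/
theorem evalAt_wordDeriv_mul_eq_zero {P : MvPolynomial (Fin (m + 1)) ℂ}
    {W : Submodule ℂ (ℂ × (Fin m → ℂ))} {g : GaGm m} {N : ℕ}
    (h : ∀ k < N, ∀ u : Fin k → ℂ × (Fin m → ℂ), (∀ i, u i ∈ W) → evalAt (wordDeriv u P) g = 0)
    (a : MvPolynomial (Fin (m + 1)) ℂ) :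
    ∀ k < N, ∀ u : Fin k → ℂ × (Fin m → ℂ), (∀ i, u i ∈ W) → evalAt (wordDeriv u (a * P)) g = 0 := by
  -- strengthen: for every `Q` obtained from `P` by a word of length `j` with `j + k < N`
  suffices H : ∀ (k : ℕ) (u : Fin k → ℂ × (Fin m → ℂ)), (∀ i, u i ∈ W) →
      ∀ (b : MvPolynomial (Fin (m + 1)) ℂ) {j : ℕ} (t : Fin j → ℂ × (Fin m → ℂ)), (∀ i, t i ∈ W) →
      j + k < N → evalAt (wordDeriv u (b * wordDeriv t P)) g = 0 by
    intro k hk u hu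
    simpa using H k u hu a (j := 0) Fin.elim0 (fun i => i.elim0) (by simpa using hk)
  intro k
  induction k with
  | zero =>
    intro u _ b j t ht hj
    simp only [wordDeriv_zero, evalAt, map_mul]
    have := h j (by simpa using hj) t ht
    rw [evalAt] at this
    rw [this, mul_zero]
  | succ k ih =>
    intro u hu b j t ht hj
    rw [wordDeriv_succ, Derivation.leibniz, smul_eq_mul, smul_eq_mul, wordDeriv_add]
    have hu' : ∀ i, Fin.init u i ∈ W := fun i => hu _
    have e1 : evalAt (wordDeriv (Fin.init u) (b * invDeriv (u (Fin.last k)) (wordDeriv t P))) g = 0 := by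
      have := ih (Fin.init u) hu' b (j := j + 1) (Fin.cons (u (Fin.last k)) t) (by
        intro i
        refine Fin.cases ?_ (fun i' => ?_) i
        · simpa using hu (Fin.last k)
        · simpa using ht i') (by omega)
      rwa [wordDeriv_cons] at this
    have e2 : evalAt (wordDeriv (Fin.init u) (invDeriv (u (Fin.last k)) b * wordDeriv t P)) g = 0 :=
      ih (Fin.init u) hu' _ t ht (by omega)
    rw [mul_comm (wordDeriv t P), evalAt, map_add, ← evalAt, ← evalAt, e1, e2, add_zero]

/-- **Ideal closure**: if `P` vanishes to order `≥ N` at `g` along `exp_G(W)`, so does `a · P` for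
every polynomial `a` (the functions vanishing to order `≥ N` at a point form an ideal; Roy, §3.2).
[cite: NesterenkoPhilippon2001, Ch. 11 §3.2] -/
theorem VanishesToOrder.mul_left {P : MvPolynomial (Fin (m + 1)) ℂ}
    {W : Submodule ℂ (ℂ × (Fin m → ℂ))} {g : GaGm m} {N : ℕ} (h : VanishesToOrder P W g N)
    (a : MvPolynomial (Fin (m + 1)) ℂ) : VanishesToOrder (a * P) W g N := by
  rw [vanishesToOrder_iff_wordDeriv] at h ⊢
  exact evalAt_wordDeriv_mul_eq_zero h a

/-- The zero polynomial vanishes to every order. [folklore] -/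
theorem vanishesToOrder_zero_poly (W : Submodule ℂ (ℂ × (Fin m → ℂ))) (g : GaGm m) (N : ℕ) :
    VanishesToOrder 0 W g N :=
  (vanishesToOrder_iff_wordDeriv 0 W g N).mpr fun k _ u _ => by simp [evalAt]

/-- Sums: if `P` and `Q` vanish to order `≥ N` at `g` along `exp_G(W)`, so does `P + Q`. [folklore] -/
theorem VanishesToOrder.add {P Q : MvPolynomial (Fin (m + 1)) ℂ}
    {W : Submodule ℂ (ℂ × (Fin m → ℂ))} {g : GaGm m} {N : ℕ} (hP : VanishesToOrder P W g N)
    (hQ : VanishesToOrder Q W g N) : VanishesToOrder (P + Q) W g N := by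
  rw [vanishesToOrder_iff_wordDeriv] at hP hQ ⊢
  intro k hk u hu
  rw [wordDeriv_add, evalAt, map_add, ← evalAt, ← evalAt, hP k hk u hu, hQ k hk u hu, add_zero]

/-- **Ideal closure, finite combinations**: if each `P i` vanishes to order `≥ N` at `g` along
`exp_G(W)` then so does `∑ aᵢ Pᵢ`. [folklore] -/
theorem VanishesToOrder.sum_mul {ι : Type*} (s : Finset ι) {P : ι → MvPolynomial (Fin (m + 1)) ℂ}
    {W : Submodule ℂ (ℂ × (Fin m → ℂ))} {g : GaGm m} {N : ℕ}
    (h : ∀ i ∈ s, VanishesToOrder (P i) W g N) (a : ι → MvPolynomial (Fin (m + 1)) ℂ) :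
    VanishesToOrder (∑ i ∈ s, a i * P i) W g N := by
  classical
  induction s using Finset.induction_on with
  | empty => simpa using vanishesToOrder_zero_poly W g N
  | insert i s hi ih =>
    rw [Finset.sum_insert hi]
    exact ((h i (Finset.mem_insert_self i s)).mul_left (a i)).add
      (ih fun i' hi' => h i' (Finset.mem_insert_of_mem hi'))

end GaGm

end Literature.NumberTheory.Transcendental
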